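import Summits.ABC.IUTFork.Joshi.RosettaFragment13Bridge
import Summits.ABC.IUTFork.Joshi.RosettaFragment3OfHol
import HarnessLib

/-!
# T-16 ↔ T-17 bridge RECONCILIATION: `Rosetta.LocalHolDatum.toStripDatum` = `ATS3.StripDatum.ofLocalHol`

Proof-only (no new definitions). Two seats paid the same merge-debt («`Π`, `G`, the holomorphoid index = T-16
carriers» of E-t17's `RosettaFragment3.lean`) within the same minute: E-t17's `ATS3.StripDatum.ofLocalHol`
(`Joshi/RosettaFragment3OfHol.lean`, p429857 — the construction OF RECORD, it lives next to `StripDatum`) and E-t16's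
`Rosetta.LocalHolDatum.toStripDatum` (`Joshi/RosettaFragment13Bridge.lean`, p429906). This file shows in kernel that
the two are THE SAME OBJECT, so nothing forks: (1) the two input formats are interchangeable — E-t16's
«`q ≠ 0 ∧ v(q) < 1` in `L_v`» versus E-t17's «`0 < ‖q‖_{K_v} < 1`» — by `norm_algebraMap_lt_one_iff_valuation_lt_one`
(PROVED from the single Fragment-1 carrier field `LocalHolDatum.norm_algebraMap_le_one_iff`, both directions), so a
`TateSupplement` is built from valuation data (`tateSupplementOfValuation`, a term of E-t17's structure — not a new
notion); (2) `toStripDatum_eq_ofLocalHol`: E-t16's strip datum EQUALS E-t17's on that supplement (by `rfl` — definitional up to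
proof irrelevance: same `proj`, `emb`, `Lv`, Galois action, absolute value, `q`, `ℓ`). Users import E-t17's
`StripDatum.ofLocalHol`; every lemma about either transfers. K. Joshi, arXiv:2401.13508v4 §8.3/§8.5 (bib
`Joshi2024ATS3`, unrefereed, `disputed`); typed ≠ proved ≠ endorsed; no side taken on [IUTchIII] Cor. 3.12 or on any
author. Standard axioms only; sorry-free. bears_on: LADDER-ABC:A2.E.
-/

noncomputable section

open scoped ValuativeRel

namespace Summit.ABC.IUTFork.Joshi.Rosetta

open Summit.ABC.IUTFork.Joshi.ATS3

variable {p : ℕ} [Fact p.Prime] {Lv : Type} [Field Lv] [ValuativeRel Lv] {U : Untilt p} [Algebra Lv U.K]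
  {Γ : Type} [Group Γ] [TopologicalSpace Γ]

/-- PROVED: under the Fragment-1 unit-ball field, «norm `< 1` in `K_v`» and «valuation `< 1` in `L_v`» agree on `L_v`
(forward direction: `RosettaFragment13Bridge`; backward: if `v(x) ≥ 1` then `x⁻¹ ∈ 𝒪_{L_v}`, so `‖ι x⁻¹‖ ≤ 1`). -/
theorem norm_algebraMap_lt_one_iff_valuation_lt_one (H : LocalHolDatum Lv U Γ) (x : Lv) :
    ‖algebraMap Lv U.K x‖ < 1 ↔ ValuativeRel.valuation Lv x < 1 := by
  refine ⟨fun hn => ?_, norm_algebraMap_lt_one_of_valuation_lt_one H⟩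
  by_contra hv
  have hv1 : 1 ≤ ValuativeRel.valuation Lv x := not_lt.mp hv
  have hx0 : x ≠ 0 := by
    rintro rfl
    simp at hv1
  have hinv : x⁻¹ ∈ 𝒪[Lv] := by
    change ValuativeRel.valuation Lv x⁻¹ ≤ 1
    rw [map_inv₀]
    exact inv_le_one_of_one_le₀ hv1
  have h1 : ‖algebraMap Lv U.K x⁻¹‖ ≤ 1 := (H.norm_algebraMap_le_one_iff x⁻¹).mpr hinv
  rw [map_inv₀, norm_inv] at h1
  have hnpos : 0 < ‖algebraMap Lv U.K x‖ := by
    rw [norm_pos_iff]; exact (map_ne_zero _).mpr hx0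
  have : 1 ≤ ‖algebraMap Lv U.K x‖ := by
    by_contra hlt
    have hlt' : ‖algebraMap Lv U.K x‖ < 1 := not_le.mp hlt
    have : 1 < ‖algebraMap Lv U.K x‖⁻¹ := (one_lt_inv₀ hnpos).mpr hlt'
    exact absurd h1 (not_le.mpr this)
  exact absurd hn (not_lt.mpr this)

/-- E-t17's `TateSupplement` BUILT from valuation-style data (`q ≠ 0`, `v(q) < 1`, `ℓ`, Galois isometry): a term of the
existing structure, no new notion. [claim: Joshi2024ATS3, status: disputed] -/
def tateSupplementOfValuation (H : LocalHolDatum Lv U Γ) (hgal : GalIsometric Lv U) (q : Lv) (hq0 : q ≠ 0)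
    (hq1 : ValuativeRel.valuation Lv q < 1) (ℓ : ℕ) : TateSupplement Lv U where
  q := q
  norm_q_pos := by
    rw [norm_pos_iff]; exact (map_ne_zero _).mpr hq0
  norm_q_lt_one := norm_algebraMap_lt_one_of_valuation_lt_one H hq1
  ell := ℓ
  norm_gal := hgal

/-- PROVED — **the two bridges coincide, definitionally**: E-t16's `toStripDatum` IS E-t17's `StripDatum.ofLocalHol`
on the supplement built from the same inputs (same projection, inclusion, image of `L_v`, tautological Galois action —
Mathlib's `MulSemiringAction.toRingAut` and E-t17's `galRingAut` agree by `rfl` —, norm, `q`, `ℓ`); the proof is `rfl`. -/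
theorem toStripDatum_eq_ofLocalHol (H : LocalHolDatum Lv U Γ) (hgal : GalIsometric Lv U) (q : Lv) (hq0 : q ≠ 0)
    (hq1 : ValuativeRel.valuation Lv q < 1) (ℓ : ℕ) :
    H.toStripDatum hgal q hq0 hq1 ℓ = StripDatum.ofLocalHol H (tateSupplementOfValuation H hgal q hq0 hq1 ℓ) := by
  rfl

end Summit.ABC.IUTFork.Joshi.Rosetta

end
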